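import Literature.MathematicalPhysics.QuantumFieldTheory.Balaban1983to89.Node00.CarriersB8SubBPCutP5
import Literature.MathematicalPhysics.QuantumFieldTheory.Balaban1983to89.Node00.CarriersB8SubBP2DPerKappa
import Literature.MathematicalPhysics.QuantumFieldTheory.Balaban1983to89.B8Prop5LandauDataZdPer

/-!
# NODE 00 (YM-PLAN Track A) — «THE κ-CUT P₅-PINS»: PROPOSITION 5's CARRIERS OF THE CUT RESIDUAL LAYER PINNED TO PRINT'S FAMILY OVER PRINT'S (1.3)–(1.4) CLASS AT THE PINNED
# BLOCK SIZE — §1–§3 the ℤᵈ pin `IdxB8LanCκ θ M₁ R` ∕ `ResidB8.cutSubBP₅κ λ M₁ R c₁ ρ₀` (dag-n05-w1's `IdxB8LanC` ∕ `cutSubBP₅` cut by `Admissible134` exactly as `IdxB8SubDκ` cuts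
# `IdxB8SubD`; the BANKED ℤᵈ twin's pin) and §4 the PERIODIC pin OF RECORD `IdxB8LanCκPer θ P M₁ R` ∕ `ResidB8.cutSubBP₅κPer λ P M₁ R c₁ ρ₀` (print-class PERIODIC member ×
# unitary `P`-PERIODIC background; members dag-n05-c's `zdLanPer`, (R0)); `rfl` ∕ `Iff.rfl` faces, honesty both ways, non-vacuity, the κ-cut slots read at the pins

[Balaban1985RegularSpaces] = T. Bałaban, *Spaces of regular gauge field configurations on a lattice and gauge fixing conditions*, Commun. Math. Phys. **99**
(1985) 75–102: Prop. 5 p. 94 («Let us consider the equations (1.107) for `U₀ ∈ 𝔄_k({Ω_j}, α₀)`» — on the torus `T_η`, over the sequences of domains of (1.3)–(1.4) p. 77: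
«Ω_j is a sum of big blocks of size M₁Lʲη … (Lʲη)⁻¹ dist(Ω_jᶜ, Ω_{j+1}) > RM₁ … M₁ is fixed in [4]»), Prop. 6 p. 99, Thm 2 p. 83, Lemma 1 – Thm 8 pp. 79–101.

CITATION HEADER (lean-in-tree rule).  Cell `pub-ymgap` (HUMAN RULING D-0062, Track A), NODE 00 object layer for N05 = [B8]; seat `pub-ymgap-dag-n05-d` (g14), 2026-08-28; ONE
DECLARER by plan g87 «DESIGN-Q2-v2» ∕ «N05-GO (R1)» ∕ «LOCATED4 (R1′)»; director-ym №227 (b′-2) «K2 — GO», №227 (b) «GUARDED REQUIRED».  Bears on K1⁹ `stmt-QuantumFields-27364`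
(`--supports`, count-neutral).
WHY.  The κ-cut of record (FLAG №10, CLOSED №225) cuts the [B8] FAMILY index of N05's witness slot to print's class at the pinned `M₁`, but the slot's Proposition-5 conjuncts
read `λ.cutSubBP₅ c₁ ρ₀`'s index `IdxB8LanC θ` — EVERY (1.3)–(1.5)-as-typed `Ω₀ = ℤᵈ` law member × unitary background, on `ℤᵈ` (this seat's LOCATED-3; dag-n05-c's LOCATED-4:
the members `zdLan` are infinite-volume data).  Print's Proposition 5 is on `T_η` over print's class; so the witness slot OF RECORD pins Proposition 5 to §4's `cutSubBP₅κPer`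
(plan (R3′): `Slot8κ′ := … B8LeafOfRecordSubBP₂DPerκ θ₃ P M₁ R ⟨lam8.cutSubBP₅κPer P M₁ R c₁ ρ₀, ax⟩`), and the banked ℤᵈ twin to §2's `cutSubBP₅κ`.  Nothing else changes:
Proposition 6's index `IdxB8SubB θ` stays (Prop. 6 is PROVED class-wide, dag-n05-e), Lemma 1's carriers are geometry-free, the [B8] family index is dag-n05-w1's κ-cut.
WHAT.  §1 `IdxB8LanCκ θ M₁ R := {a : IdxB8LanC θ ∕∕ Admissible134 θ.L M₁ R a.mem.k a.mem.Ω}` + faces (`toLanC`, `toZdLanIdx`, `toSubDκ`, `admissible`, the P₅-pin's `ι`-law faces BY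
NAME), `nonempty_idxB8LanCκ`, members `lanOfRecordSubCκ`.  §2 `ResidB8.cutSubBP₅κ λ M₁ R c₁ ρ₀` + `rfl` faces, honesty both ways, non-vacuity.  §3 dag-n05-w1's κ-cut «P₂D» slot
`B8LeafOfRecordSubBP₂Dκ θ M₁ R` read at the ℤᵈ κ-pin (`Iff.rfl`), Prop. 5's conjuncts member by member.  §4 `structure IdxB8LanCκPer θ P M₁ R` (`mem : IdxB8SubDPerκ θ P M₁ R`, unitary
`P`-periodic `U₀`) + faces, `nonempty_idxB8LanCκPer` (`1 ≤ M₁`, `θ.L ≤ R·M₁`, `0 < P`, `M₁·θ.L ∣ P`), members `lanOfRecordSubCκPer … := zdLanPer …`, ★★ `ResidB8.cutSubBP₅κPer λ P M₁ R c₁ ρ₀` +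
faces, honesty both ways, non-vacuity, ★★ `b8LeafOfRecordSubBP₂DPerκ_cutSubBP₅κPer_iff` (the witness slot of record at the pin, `Iff.rfl`), `prop5_cutSubBP₅κPer_reads`.
HONEST FRAMING: definitions (index cuts, readings ∕ members, named instances of dag-n05-e's cut) and `rfl` bookkeeping — nothing of [Balaban1985RegularSpaces] Proposition 5 is
asserted or discharged here; the pins only fix WHICH family the slot's Prop-5 conjuncts speak about (print's, on the torus, over print's class at the pinned `M₁`); N05 NOT
discharged; counts unmoved; count-neutral; one finite T⁴ programme at fixed ε, Bałaban AS PRINTED — NOT continuum ∕ ℝ⁴ ∕ infinite volume ∕ OS ∕ mass gap ∕ Clay.  No `sorry`,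
no `axiom`, no `opaque`, no `instance`, no `notation`.  Unit `pub-ymgap-dag-n05-d` (g14). -/

noncomputable section

namespace Literature.MathematicalPhysics.QuantumFieldTheory.Balaban1983to89.Node00

open DagBinding
open B8LeafKnitRSC (B8LeafRSC)
open B8LeafModelZd (ZdIdx)
open B8LeafModelZd3P2 (zdGF3P₂ zdGF3HP₂)
open B8Lemma1NonAbelian (blockPairNA)
open B8IdxB8LawsB (IdxB8LawsB IdxB8SubB)
open B8ConstraintBonds (DomainSeq Lam)
open B8Prop5LandauDataZd (ZdLanIdx zdLan)
open B8Prop5LandauDataZdPer (zdLanPer)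
open B8LeafKnitRS (B8LeafRS)
open T4TermwiseTorus (IsPeriodic)
open B8Prop7TowerAxialRecord (toAxialTowerResid)
open B8Eq134Admissible (Admissible134)
open B7Prop2Explicit (unitaryUnits)
open B7Prop1Local (InBox)
open B8Ineq130 (tlo thi)

/-! ## §1. Proposition 5's index of record CUT TO PRINT'S CLASS at the pinned `(M₁, R)`, its readings, the `ι`-law faces, the members of record -/

section IndexP5κ

variable (θ : Stage3Params)

/-- ★ **PROPOSITION 5's INDEX OF RECORD OVER PRINT'S (1.3)–(1.4) CLASS AT THE PINNED BLOCK SIZE**: the members `a : IdxB8LanC θ` (a (1.5)-obeying admissible collar-law member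
`a.mem` with a unitary background `a.U₀`) whose domain sequence satisfies print's LITERAL (1.3)–(1.4) `Admissible134 θ.L M₁ R k Ω` — «Ω_j is a sum of big blocks of size
M₁Lʲη, (Lʲη)⁻¹ dist(Ω_jᶜ, Ω_{j+1}) > RM₁» — at the PINNED `M₁` («fixed in [4]») and separation constant `R`; the cut `IdxB8SubDκ θ M₁ R` makes on `IdxB8SubD θ`, made on
Proposition 5's index. [cite: Balaban1985RegularSpaces, Prop. 5 p.94 («for `U₀ ∈ 𝔄_k({Ω_j}, α₀)`»), (1.3)–(1.4) p.77 («M₁ … fixed in [4]»)] -/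
def IdxB8LanCκ (M₁ R : ℕ) : Type :=
  {a : IdxB8LanC θ // Admissible134 θ.L M₁ R a.mem.1.1.1.1.k a.mem.1.1.1.1.Ω}

variable {θ} {M₁ R : ℕ}

/-- The forgetful map to Proposition 5's index of record (`Subtype.val`). [cite: Balaban1985RegularSpaces, Prop. 5 p.94 (bookkeeping)] -/
def IdxB8LanCκ.toLanC (a : IdxB8LanCκ θ M₁ R) : IdxB8LanC θ := a.1

/-- The `ZdLanIdx` READING of a print-class member of the index: the P₅-pin's reading of the underlying member (spacing, levels, domains, top constraint sets, background).
[cite: Balaban1985RegularSpaces, (1.3)–(1.5) p.77, (1.29) p.81, p.89, Prop. 5 p.94] -/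
def IdxB8LanCκ.toZdLanIdx (a : IdxB8LanCκ θ M₁ R) : ZdLanIdx θ.D θ.𝔸 := a.1.toZdLanIdx

/-- The reading IS the P₅-pin's reading of the underlying member (`rfl`). [cite: Balaban1985RegularSpaces, Prop. 5 p.94 (bookkeeping)] -/
theorem IdxB8LanCκ.toZdLanIdx_eq (a : IdxB8LanCκ θ M₁ R) : a.toZdLanIdx = a.1.toZdLanIdx := rfl

/-- The member's print-class law: (1.3)–(1.4) LITERALLY at the pinned `(M₁, R)`. [cite: Balaban1985RegularSpaces, (1.3)–(1.4) p.77] -/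
theorem IdxB8LanCκ.admissible (a : IdxB8LanCκ θ M₁ R) : Admissible134 θ.L M₁ R a.1.mem.1.1.1.1.k a.1.mem.1.1.1.1.Ω := a.2

/-- The underlying admissible member AS A κ-MEMBER of dag-n05-w1's cut index `IdxB8SubDκ θ M₁ R` (same law). [cite: Balaban1985RegularSpaces, (1.3)–(1.4) p.77 (bookkeeping)] -/
def IdxB8LanCκ.toSubDκ (a : IdxB8LanCκ θ M₁ R) : IdxB8SubDκ θ M₁ R := ⟨a.1.mem, a.2⟩

/-- `toSubDκ` projects to the member (`rfl`). [cite: Balaban1985RegularSpaces, (1.3)–(1.4) p.77 (bookkeeping)] -/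
theorem IdxB8LanCκ.toSubDκ_val (a : IdxB8LanCκ θ M₁ R) : a.toSubDκ.1 = a.1.mem := rfl

/-- `ι`-LAW FACE `hΩ0L`: every member has `Ω₀ = ℤᵈ` (the P₅-pin's face at the underlying member). [cite: Balaban1985RegularSpaces, p.77 («we admit … Ω_j = T_η»)] -/
theorem IdxB8LanCκ.hΩ0L (a : IdxB8LanCκ θ M₁ R) : a.toZdLanIdx.Ω 0 = Set.univ := a.1.hΩ0L

/-- `ι`-LAW FACE `hΩL`: the domain sequence is decreasing. [cite: Balaban1985RegularSpaces, (1.3) p.77] -/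
theorem IdxB8LanCκ.hΩL (a : IdxB8LanCκ θ M₁ R) : ∀ j, a.toZdLanIdx.Ω (j + 1) ⊆ a.toZdLanIdx.Ω j := a.1.hΩL

/-- `ι`-LAW FACE `htowerL`: the big blocks over the top constraint sets lie in the domains, «`Bʲ(Λ_j) ⊂ Ω_j`». [cite: Balaban1985RegularSpaces, (1.5) p.77, (1.28)–(1.29) p.81] -/
theorem IdxB8LanCκ.htowerL (a : IdxB8LanCκ θ M₁ R) :
    ∀ j, j ≤ a.toZdLanIdx.k → ∀ y ∈ a.toZdLanIdx.Λ j, ∀ x, InBox (tlo θ.L y j) (thi θ.L y j) x → x ∈ a.toZdLanIdx.Ω j :=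
  a.1.htowerL

/-- The member's four located laws (n05-c's `IdxB8LawsB`). [cite: Balaban1985RegularSpaces, (1.5)–(1.6) p.77, p.98] -/
theorem IdxB8LanCκ.lawsB (a : IdxB8LanCκ θ M₁ R) : IdxB8LawsB θ.L a.1.mem.1.1.1.1 := a.1.lawsB

/-- The member's (1.3)–(1.4) domain law as typed (`DomainSeq`). [cite: Balaban1985RegularSpaces, (1.3)–(1.4) p.77] -/
theorem IdxB8LanCκ.domainSeq (a : IdxB8LanCκ θ M₁ R) : DomainSeq θ.L a.toZdLanIdx.Ω := a.1.domainSeq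

/-- `ι`-LAW FACE (1.5): the reading's constraint family `Λ = Λs k` puts every label of level `l < k` at a corner in print's layer `Λ_l`. [cite: Balaban1985RegularSpaces, (1.5) p.77] -/
theorem IdxB8LanCκ.hlamTop (a : IdxB8LanCκ θ M₁ R) :
    ∀ l, l < a.toZdLanIdx.k → ∀ z ∈ a.toZdLanIdx.Λ l, ((θ.L : ℤ) ^ l) • z ∈ Lam θ.L a.toZdLanIdx.Ω l :=
  a.1.hlamTop

/-- ★ **NON-VACUITY**: for `1 ≤ M₁` and `θ.L ≤ R·M₁` the print-class index is inhabited — a print-class member exists (dag-n05-w1's `nonempty_idxB8SubDκ`, dag-n05-w2's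
nested print tower) and `U₀ := 1` is unitary. [cite: Balaban1985RegularSpaces, Prop. 5 p.94, (1.3)–(1.4) p.77 (bookkeeping)] -/
theorem nonempty_idxB8LanCκ (hM₁ : 1 ≤ M₁) (hRM : θ.L ≤ R * M₁) : Nonempty (IdxB8LanCκ θ M₁ R) := by
  obtain ⟨j⟩ := nonempty_idxB8SubDκ (θ := θ) hM₁ hRM
  exact ⟨⟨⟨j.1, fun _ _ => 1, fun _ _ => Subgroup.one_mem _⟩, j.2⟩⟩

variable (θ M₁ R)

/-- **PROPOSITION 5's MEMBERS OF RECORD OVER PRINT'S CLASS** with constant `B₁`: member `a ↦ zdLan θ.L B₁ a.toZdLanIdx` — the P₅-pin's members of record restricted along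
`Subtype.val`; print's family p. 94 over print's (1.3)–(1.4) domains and nothing narrower or wider.
[cite: Balaban1985RegularSpaces, Prop. 5 (1.107)–(1.109) p.94, (1.68)–(1.69) p.88, (1.73)–(1.74) pp.88–89, (1.102) p.93, (1.33) p.82, (1.3)–(1.4) p.77] -/
def lanOfRecordSubCκ (B₁ : ℝ) : IdxB8LanCκ θ M₁ R → B8.LandauData :=
  fun a => zdLan θ.L B₁ a.toZdLanIdx

/-- The member of record unfolded (`rfl`). [cite: Balaban1985RegularSpaces, Prop. 5 p.94 (bookkeeping)] -/
theorem lanOfRecordSubCκ_apply (B₁ : ℝ) (a : IdxB8LanCκ θ M₁ R) : lanOfRecordSubCκ θ M₁ R B₁ a = zdLan θ.L B₁ a.1.toZdLanIdx := rfl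

/-- The members of record over print's class ARE the P₅-pin's members of record restricted along `Subtype.val` (`rfl`). [cite: Balaban1985RegularSpaces, Prop. 5 p.94 (bookkeeping)] -/
theorem lanOfRecordSubCκ_eq_comp (B₁ : ℝ) : lanOfRecordSubCκ θ M₁ R B₁ = fun a : IdxB8LanCκ θ M₁ R => lanOfRecordSubC θ B₁ a.1 := rfl

end IndexP5κ

/-! ## §2. The κ-pinned cut layer `ResidB8.cutSubBP₅κ`; field faces; honesty both ways -/

section CutP5κ

variable {θ : Stage3Params}

/-- ★ **THE κ-CUT P₅-PINNED CUT RESIDUAL LAYER**: dag-n05-e's print-class cut `λ.cutSubBP J lan c₁ ρ₀` with Proposition 5's carriers PINNED to print's family OVER PRINT'S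
(1.3)–(1.4) CLASS at the pinned `(M₁, R)` — index `IdxB8LanCκ θ M₁ R`, members `fun a => zdLan θ.L λ.B₁ a.toZdLanIdx` (Prop. 5's constant `B₁` = the layer's Thm-2 constant).
LITERALLY `λ.cutSubBP J (fun a => zdLan θ.L λ.B₁ (ι a)) c₁ ρ₀` at `J := IdxB8LanCκ θ M₁ R`, `ι := IdxB8LanCκ.toZdLanIdx`; the P₅-pin `λ.cutSubBP₅ c₁ ρ₀` is the case without
the class cut. [cite: Balaban1985RegularSpaces, Prop. 5 p.94, Prop. 6 p.99, Thm 2 p.83, (1.3)–(1.4) p.77 (objects of record)] -/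
def ResidB8.cutSubBP₅κ (lam : ResidB8 θ) (M₁ R : ℕ) (c₁ : ℝ) (ρ₀ : ℕ) : ResidB8 θ :=
  lam.cutSubBP (IdxB8LanCκ θ M₁ R) (fun a => zdLan θ.L lam.B₁ a.toZdLanIdx) c₁ ρ₀

variable {M₁ R : ℕ}

/-- Unfolding (`rfl`): the κ-pinned layer IS the generic print-class cut at `(IdxB8LanCκ θ M₁ R, fun a => zdLan θ.L λ.B₁ a.toZdLanIdx)`.
[cite: Balaban1985RegularSpaces, Prop. 5 p.94 (bookkeeping)] -/
theorem ResidB8.cutSubBP₅κ_eq_cutSubBP (lam : ResidB8 θ) (c₁ : ℝ) (ρ₀ : ℕ) :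
    lam.cutSubBP₅κ M₁ R c₁ ρ₀ = lam.cutSubBP (IdxB8LanCκ θ M₁ R) (fun a => zdLan θ.L lam.B₁ a.toZdLanIdx) c₁ ρ₀ := rfl

/-- Proposition 5's index at the κ-pin IS `IdxB8LanCκ θ M₁ R` (`rfl`). [cite: Balaban1985RegularSpaces, Prop. 5 p.94 (bookkeeping)] -/
theorem ResidB8.cutSubBP₅κ_I8c (lam : ResidB8 θ) (c₁ : ℝ) (ρ₀ : ℕ) : (lam.cutSubBP₅κ M₁ R c₁ ρ₀).I8c = IdxB8LanCκ θ M₁ R := rfl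

/-- Proposition 5's members at the κ-pin ARE the members of record over print's class at `B₁ := λ.B₁` (`rfl`). [cite: Balaban1985RegularSpaces, Prop. 5 p.94 (bookkeeping)] -/
theorem ResidB8.cutSubBP₅κ_lan (lam : ResidB8 θ) (c₁ : ℝ) (ρ₀ : ℕ) : (lam.cutSubBP₅κ M₁ R c₁ ρ₀).lan = lanOfRecordSubCκ θ M₁ R lam.B₁ := rfl

/-- **HONESTY (no junk member)**: EVERY Proposition-5 member of the κ-pinned layer is print's datum `zdLan θ.L λ.B₁ ⟨η, k, Ω, Λ_k, U₀⟩` at a PRINT-CLASS admissible collar-law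
member and a unitary background (`rfl`). [cite: Balaban1985RegularSpaces, Prop. 5 p.94 («for `U₀ ∈ 𝔄_k({Ω_j}, α₀)`»), (1.3)–(1.4) p.77] -/
theorem ResidB8.cutSubBP₅κ_lan_apply (lam : ResidB8 θ) (c₁ : ℝ) (ρ₀ : ℕ) (a : IdxB8LanCκ θ M₁ R) :
    (lam.cutSubBP₅κ M₁ R c₁ ρ₀).lan a =
      zdLan θ.L lam.B₁ ⟨a.1.mem.1.1.1.1.η, a.1.mem.1.1.1.1.hη, a.1.mem.1.1.1.1.k, a.1.mem.1.1.1.1.hk, a.1.mem.1.1.1.1.Ω,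
        a.1.mem.1.1.1.1.Λs a.1.mem.1.1.1.1.k, a.1.U₀, a.1.hU₀⟩ := rfl

/-- ★ **HONESTY (every honest datum is a member)**: for EVERY `Ω₀ = ℤᵈ` four-law member `i` obeying (1.3)–(1.4) as typed, print's (1.5) on its top family AND print's LITERAL
(1.3)–(1.4) `Admissible134 θ.L M₁ R i.k i.Ω` at the pinned `(M₁, R)`, and EVERY unitary background `U₀`, print's Proposition-5 datum `zdLan θ.L λ.B₁ ⟨i.η, i.hη, i.k, i.hk,
i.Ω, i.Λs i.k, U₀, hU₀⟩` IS a Proposition-5 member of the κ-pinned layer (`rfl`). [cite: Balaban1985RegularSpaces, Prop. 5 p.94, (1.3)–(1.5) p.77] -/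
theorem ResidB8.exists_mem_cutSubBP₅κ_lan_eq_zdLan (lam : ResidB8 θ) (c₁ : ℝ) (ρ₀ : ℕ) (i : ZdIdx θ.D θ.L)
    (U₀ : B7Prop1Explicit.Site θ.D → Fin θ.D → θ.𝔸ˣ) (hU₀ : ∀ x κ, U₀ x κ ∈ unitaryUnits θ.𝔸)
    (hΩ0 : i.Ω 0 = Set.univ) (hlaws : IdxB8LawsB θ.L i) (hdom : DomainSeq θ.L i.Ω)
    (hlam : ∀ l, l < i.k → ∀ z ∈ i.Λs i.k l, ((θ.L : ℤ) ^ l) • z ∈ Lam θ.L i.Ω l) (hadm : Admissible134 θ.L M₁ R i.k i.Ω) :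
    ∃ a : (lam.cutSubBP₅κ M₁ R c₁ ρ₀).I8c, (lam.cutSubBP₅κ M₁ R c₁ ρ₀).lan a = zdLan θ.L lam.B₁ ⟨i.η, i.hη, i.k, i.hk, i.Ω, i.Λs i.k, U₀, hU₀⟩ :=
  ⟨⟨IdxB8LanC.mk ⟨⟨⟨⟨i, hΩ0⟩, hlaws⟩, hdom⟩, hlam⟩ U₀ hU₀, hadm⟩, rfl⟩

/-- Proposition 6's index and members at the κ-pin are dag-n05-e's print-class ones (`rfl` ×2) — Prop. 6 is proved class-wide (dag-n05-e), its index is NOT cut.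
[cite: Balaban1985RegularSpaces, Prop. 6 p.99, p.98 (bookkeeping)] -/
theorem ResidB8.cutSubBP₅κ_I8d_cub (lam : ResidB8 θ) (c₁ : ℝ) (ρ₀ : ℕ) :
    (lam.cutSubBP₅κ M₁ R c₁ ρ₀).I8d = IdxB8SubB θ ∧ (lam.cutSubBP₅κ M₁ R c₁ ρ₀).cub = (fun j : IdxB8SubB θ => zdCubP θ.𝔸 θ.L ρ₀ j.1.1) :=
  ⟨rfl, rfl⟩

/-- The threshold at the κ-pin is `c₁`; the Hölder data, the [B9] inputs, the shared constants and Proposition 7's axial map are the layer's own (`rfl` ×10).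
[cite: Balaban1985RegularSpaces, Thm 2 p.83, Prop. 3 p.87, Thm 4 p.88, Prop. 7 p.100 (bookkeeping)] -/
theorem ResidB8.cutSubBP₅κ_consts (lam : ResidB8 θ) (c₁ : ℝ) (ρ₀ : ℕ) :
    (lam.cutSubBP₅κ M₁ R c₁ ρ₀).c₁ = c₁ ∧ (lam.cutSubBP₅κ M₁ R c₁ ρ₀).β = lam.β ∧ (lam.cutSubBP₅κ M₁ R c₁ ρ₀).len = lam.len ∧
      (lam.cutSubBP₅κ M₁ R c₁ ρ₀).inp = lam.inp ∧ (lam.cutSubBP₅κ M₁ R c₁ ρ₀).C₂ = lam.C₂ ∧ (lam.cutSubBP₅κ M₁ R c₁ ρ₀).B₁' = lam.B₁' ∧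
      (lam.cutSubBP₅κ M₁ R c₁ ρ₀).B₁ = lam.B₁ ∧ (lam.cutSubBP₅κ M₁ R c₁ ρ₀).B₂ = lam.B₂ ∧ (lam.cutSubBP₅κ M₁ R c₁ ρ₀).B₀β = lam.B₀β ∧
      (lam.cutSubBP₅κ M₁ R c₁ ρ₀).toAxial = lam.toAxial :=
  ⟨rfl, rfl, rfl, rfl, rfl, rfl, rfl, rfl, rfl, rfl⟩

/-- Non-vacuity of BOTH located indices at the κ-pin for `1 ≤ M₁`, `θ.L ≤ R·M₁`: Proposition 5's (`nonempty_idxB8LanCκ`) and Proposition 6's (n05-c's `nonempty_idxB8SubB`).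
[cite: Balaban1985RegularSpaces, Prop. 5 p.94, Prop. 6 p.99 (bookkeeping)] -/
theorem ResidB8.nonempty_cutSubBP₅κ_I8c_I8d (lam : ResidB8 θ) (c₁ : ℝ) (ρ₀ : ℕ) (hM₁ : 1 ≤ M₁) (hRM : θ.L ≤ R * M₁) :
    Nonempty (lam.cutSubBP₅κ M₁ R c₁ ρ₀).I8c ∧ Nonempty (lam.cutSubBP₅κ M₁ R c₁ ρ₀).I8d :=
  ⟨nonempty_idxB8LanCκ hM₁ hRM, B8IdxB8LawsB.nonempty_idxB8SubB θ⟩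

end CutP5κ

/-! ## §3. The κ-cut «P₂D» slot `B8LeafOfRecordSubBP₂Dκ θ M₁ R` (`Node00/CarriersB8SubDKappa`) at the κ-pin: transfer from the generic cut, the reading, Prop. 5's conjuncts member by member -/

section SlotAtP5κ

variable {θ : Stage3Params} {M₁ R : ℕ}

/-- **TRANSFER** (`Iff.rfl`): the κ-cut slot at the κ-pin IS the κ-cut slot at the generic print-class cut `λ.cutSubBP J (fun a => zdLan θ.L λ.B₁ (ι a)) c₁ ρ₀` for
`J := IdxB8LanCκ θ M₁ R`, `ι := IdxB8LanCκ.toZdLanIdx` — so every knit concluding at the generic cut for `(J, ι)` with the `ι`-law binders instantiates at the κ-pin with §1's faces.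
[cite: Balaban1985RegularSpaces, Lemma 1 – Thm 8 pp.79–101 (bookkeeping)] -/
theorem b8LeafOfRecordSubBP₂Dκ_cutSubBP₅κ_iff_cutSubBP (lam : ResidB8 θ) (c₁ : ℝ) (ρ₀ : ℕ) :
    B8LeafOfRecordSubBP₂Dκ θ M₁ R (lam.cutSubBP₅κ M₁ R c₁ ρ₀) ↔
      B8LeafOfRecordSubBP₂Dκ θ M₁ R (lam.cutSubBP (IdxB8LanCκ θ M₁ R) (fun a => zdLan θ.L lam.B₁ a.toZdLanIdx) c₁ ρ₀) :=
  Iff.rfl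

/-- **THE κ-CUT SLOT AT THE κ-PIN READS** (`Iff.rfl`): the `B8LeafRSC` leaf at `c₇OfRecord θ` over the δ₂-members AT THE PRINT-CLASS MEMBERS `IdxB8SubDκ θ M₁ R`, Proposition 5
at the MEMBERS OF RECORD OVER PRINT'S CLASS `lanOfRecordSubCκ θ M₁ R λ.B₁`, Proposition 6 at the print cubes `zdCubP … ρ₀`, print's axial map, threshold `c₁` — EVERY index
the [B8]-geometry-reading conjuncts quantify over is print's (1.3)–(1.4) class at the pinned `M₁`. [cite: Balaban1985RegularSpaces, Lemma 1 – Thm 8 pp.79–101, (1.3)–(1.4) p.77 (bookkeeping)] -/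
theorem b8LeafOfRecordSubBP₂Dκ_cutSubBP₅κ_iff (lam : ResidB8 θ) (c₁ : ℝ) (ρ₀ : ℕ) :
    B8LeafOfRecordSubBP₂Dκ θ M₁ R (lam.cutSubBP₅κ M₁ R c₁ ρ₀) ↔
      B8LeafRSC θ.D (θ.L : ℝ) lam.C₂ lam.B₁' lam.inp.B₀' lam.B₁ lam.B₂ c₁ lam.inp lam.B₀β (c₇OfRecord θ) (blockPairNA θ.D θ.L θ.𝔸)
        (fun j : IdxB8SubDκ θ M₁ R => famB8OfRecordSubBP₂D θ lam.β lam.len j.1) (lanOfRecordSubCκ θ M₁ R lam.B₁)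
        (fun j : IdxB8SubB θ => zdCubP θ.𝔸 θ.L ρ₀ j.1.1) (fun j => toAxialTowerResid θ lam.β lam.len j.1.1.1.1) :=
  Iff.rfl

/-- **PROPOSITION 5's TWO CONJUNCTS AT THE κ-PIN ARE PRINT'S SENTENCES OVER PRINT'S CLASS, member by member** (`Iff.rfl` ×2): existence (1.108) with the bound `8B₀′B₁(α₀+α₁)`
and uniqueness (1.109), each quantified over EVERY PRINT-CLASS admissible collar-law member and EVERY unitary background, at dag-n05-b's datum `zdLan θ.L λ.B₁ a.toZdLanIdx`.
[cite: Balaban1985RegularSpaces, Prop. 5 (1.107)–(1.109) p.94, (1.3)–(1.4) p.77] -/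
theorem prop5_cutSubBP₅κ_reads (lam : ResidB8 θ) (c₁ : ℝ) (ρ₀ : ℕ) :
    (B8.Prop5Exists (lam.cutSubBP₅κ M₁ R c₁ ρ₀).inp.B₀' (lam.cutSubBP₅κ M₁ R c₁ ρ₀).B₁ (lam.cutSubBP₅κ M₁ R c₁ ρ₀).lan ↔
        ∃ c₂ : ℝ, 0 < c₂ ∧ ∀ a : IdxB8LanCκ θ M₁ R, ∀ α₀ α₁ : ℝ, 0 < α₀ → 0 < α₁ → α₀ + α₁ ≤ c₂ →
          ∀ U₁ : (zdLan θ.L lam.B₁ a.toZdLanIdx).Cfg, (zdLan θ.L lam.B₁ a.toZdLanIdx).Hyp169 α₀ α₁ U₁ →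
            ∃ l : (zdLan θ.L lam.B₁ a.toZdLanIdx).Lam, (zdLan θ.L lam.B₁ a.toZdLanIdx).Solves U₁ l ∧
              (zdLan θ.L lam.B₁ a.toZdLanIdx).lamNorm l < 8 * lam.inp.B₀' * lam.B₁ * (α₀ + α₁)) ∧
    (B8.Prop5Unique (lam.cutSubBP₅κ M₁ R c₁ ρ₀).lan ↔
        ∃ c₂ c₃ : ℝ, 0 < c₂ ∧ 0 < c₃ ∧ ∀ a : IdxB8LanCκ θ M₁ R, ∀ α₀ α₁ : ℝ, 0 < α₀ → 0 < α₁ → α₀ + α₁ ≤ c₂ →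
          ∀ U₁ : (zdLan θ.L lam.B₁ a.toZdLanIdx).Cfg, (zdLan θ.L lam.B₁ a.toZdLanIdx).Hyp169 α₀ α₁ U₁ →
            ∀ l₁ l₂ : (zdLan θ.L lam.B₁ a.toZdLanIdx).Lam, (zdLan θ.L lam.B₁ a.toZdLanIdx).Solves U₁ l₁ → (zdLan θ.L lam.B₁ a.toZdLanIdx).Solves U₁ l₂ →
              (zdLan θ.L lam.B₁ a.toZdLanIdx).lamNorm l₁ < c₃ → (zdLan θ.L lam.B₁ a.toZdLanIdx).lamNorm l₂ < c₃ → l₁ = l₂) :=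
  ⟨Iff.rfl, Iff.rfl⟩

end SlotAtP5κ


/-! ## §4. THE PERIODIC SIBLINGS (plan LOCATED-4 ∕ (R1′), director-ym №227 (b)): Proposition 5's index over print's class WITH `P`-PERIODIC BACKGROUNDS, its members
`zdLanPer` (dag-n05-c (R0)), the cut layer `cutSubBP₅κPer` — the Prop-5 pin of the witness slot OF RECORD on the (β′-PERIODIC) road -/

section IndexP5κPer

variable (θ : Stage3Params)

/-- ★★ **PROPOSITION 5's INDEX OF THE WITNESS SLOT OF RECORD**: a PRINT-CLASS member of the PERIODIC (1.5)-index (`mem : IdxB8SubDPerκ θ P M₁ R` — domains `P`-periodic,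
`Lᵏ ∣ P`, `0 < P`, print's literal (1.3)–(1.4) at the pinned `(M₁, R)`) together with a UNITARY `P`-PERIODIC background `U₀` — print p. 94 «for `U₀ ∈ 𝔄_k({Ω_j}, α₀)`» ON THE TORUS
`T_η`, read on its universal cover. [cite: Balaban1985RegularSpaces, Prop. 5 p.94, (1.3)–(1.4) p.77, p.77 («Ω_j ⊂ T_η»)] -/
structure IdxB8LanCκPer (P M₁ R : ℕ) where
  /-- the print-class member of the periodic (1.5)-index -/
  mem : IdxB8SubDPerκ θ P M₁ R
  /-- the fixed unitary `P`-periodic background `U₀` on the bonds of `ℤ^{θ.D}` -/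
  U₀ : B7Prop1Explicit.Site θ.D → Fin θ.D → θ.𝔸ˣ
  hU₀ : ∀ x κ, U₀ x κ ∈ unitaryUnits θ.𝔸
  hper : IsPeriodic P U₀

variable {θ} {P M₁ R : ℕ}

/-- The member read in the ℤᵈ print-class index (forget the period): `⟨⟨a.mem's (1.5)-member, U₀⟩, the class law⟩`. [cite: Balaban1985RegularSpaces, Prop. 5 p.94 (bookkeeping)] -/
def IdxB8LanCκPer.toLanCκ (a : IdxB8LanCκPer θ P M₁ R) : IdxB8LanCκ θ M₁ R := ⟨⟨a.mem.1.1, a.U₀, a.hU₀⟩, a.mem.2⟩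

/-- The `ZdLanIdx` READING of a member (spacing, levels, domains, top constraint sets, background) — the ℤᵈ κ-index's reading of `toLanCκ`.
[cite: Balaban1985RegularSpaces, (1.3)–(1.5) p.77, Prop. 5 p.94] -/
def IdxB8LanCκPer.toZdLanIdx (a : IdxB8LanCκPer θ P M₁ R) : ZdLanIdx θ.D θ.𝔸 := a.toLanCκ.toZdLanIdx

/-- The reading unfolded (`rfl`). [cite: Balaban1985RegularSpaces, Prop. 5 p.94 (bookkeeping)] -/
theorem IdxB8LanCκPer.toZdLanIdx_eq (a : IdxB8LanCκPer θ P M₁ R) :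
    a.toZdLanIdx = ⟨a.mem.1.1.1.1.1.1.η, a.mem.1.1.1.1.1.1.hη, a.mem.1.1.1.1.1.1.k, a.mem.1.1.1.1.1.1.hk, a.mem.1.1.1.1.1.1.Ω,
      a.mem.1.1.1.1.1.1.Λs a.mem.1.1.1.1.1.1.k, a.U₀, a.hU₀⟩ := rfl

/-- The member's print-class law at the pinned `(M₁, R)`. [cite: Balaban1985RegularSpaces, (1.3)–(1.4) p.77] -/
theorem IdxB8LanCκPer.admissible (a : IdxB8LanCκPer θ P M₁ R) : Admissible134 θ.L M₁ R a.mem.1.1.1.1.1.1.k a.mem.1.1.1.1.1.1.Ω := a.mem.2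

/-- The member's domains are `P`-periodic (the periodic index's law). [cite: Balaban1985RegularSpaces, p.77 («Ω_j ⊂ T_η»)] -/
theorem IdxB8LanCκPer.memPeriodic (a : IdxB8LanCκPer θ P M₁ R) (l : ℕ) : IsPeriodic P (fun x : B7Prop1Explicit.Site θ.D => x ∈ a.mem.1.1.1.1.1.1.Ω l) := a.mem.periodic l

/-- The background is `P`-periodic. [cite: Balaban1985RegularSpaces, p.77 («Ω_j ⊂ T_η»)] -/
theorem IdxB8LanCκPer.periodic (a : IdxB8LanCκPer θ P M₁ R) : IsPeriodic P a.U₀ := a.hper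

/-- `ι`-LAW FACES (the ℤᵈ κ-index's, BY NAME, at `toLanCκ`): `Ω₀ = ℤᵈ`, decreasing domains, towers in the domains, the four laws, `DomainSeq`, (1.5).
[cite: Balaban1985RegularSpaces, (1.3)–(1.5) p.77, (1.28)–(1.29) p.81] -/
theorem IdxB8LanCκPer.laws (a : IdxB8LanCκPer θ P M₁ R) :
    a.toZdLanIdx.Ω 0 = Set.univ ∧ (∀ j, a.toZdLanIdx.Ω (j + 1) ⊆ a.toZdLanIdx.Ω j) ∧
      (∀ j, j ≤ a.toZdLanIdx.k → ∀ y ∈ a.toZdLanIdx.Λ j, ∀ x, InBox (tlo θ.L y j) (thi θ.L y j) x → x ∈ a.toZdLanIdx.Ω j) ∧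
      IdxB8LawsB θ.L a.mem.1.1.1.1.1.1 ∧ DomainSeq θ.L a.toZdLanIdx.Ω ∧
      (∀ l, l < a.toZdLanIdx.k → ∀ z ∈ a.toZdLanIdx.Λ l, ((θ.L : ℤ) ^ l) • z ∈ Lam θ.L a.toZdLanIdx.Ω l) :=
  ⟨a.toLanCκ.hΩ0L, a.toLanCκ.hΩL, a.toLanCκ.htowerL, a.toLanCκ.lawsB, a.toLanCκ.domainSeq, a.toLanCκ.hlamTop⟩

/-- ★ **NON-VACUITY**: for `1 ≤ M₁`, `θ.L ≤ R·M₁`, `0 < P`, `M₁·θ.L ∣ P` the index is inhabited — a print-class periodic member exists (dag-n05-w1's `nonempty_idxB8SubDPerκ`) and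
`U₀ := 1` is unitary and periodic. [cite: Balaban1985RegularSpaces, Prop. 5 p.94, (1.3)–(1.4) p.77, p.77 («Ω_j ⊂ T_η») (bookkeeping)] -/
theorem nonempty_idxB8LanCκPer (hM₁ : 1 ≤ M₁) (hRM : θ.L ≤ R * M₁) (hP : 0 < P) (hdvd : M₁ * θ.L ∣ P) : Nonempty (IdxB8LanCκPer θ P M₁ R) := by
  obtain ⟨j⟩ := nonempty_idxB8SubDPerκ (θ := θ) hM₁ hRM hP hdvd
  exact ⟨⟨j, fun _ _ => 1, fun _ _ => Subgroup.one_mem _, fun _ _ => rfl⟩⟩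

variable (θ P M₁ R)

/-- ★★ **PROPOSITION 5's MEMBERS OF THE WITNESS SLOT OF RECORD** with constant `B₁`: member `a ↦ zdLanPer θ.L B₁ a.toZdLanIdx P` — dag-n05-c's `P`-periodic sub-model of print's
datum (periodic `(u₁, A)`, periodic gauge parameters; (1.33) ∧ (1.69) ∧ (1.68) ∧ (1.73)–(1.74), (1.102), (1.107) read at the underlying fields): print's family p. 94 ON THE TORUS over
print's (1.3)–(1.4) domains. [cite: Balaban1985RegularSpaces, Prop. 5 (1.107)–(1.109) p.94, (1.3)–(1.4) p.77, p.77 («Ω_j ⊂ T_η»)] -/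
def lanOfRecordSubCκPer (B₁ : ℝ) : IdxB8LanCκPer θ P M₁ R → B8.LandauData :=
  fun a => zdLanPer θ.L B₁ a.toZdLanIdx P

/-- The member of record unfolded (`rfl`). [cite: Balaban1985RegularSpaces, Prop. 5 p.94 (bookkeeping)] -/
theorem lanOfRecordSubCκPer_apply (B₁ : ℝ) (a : IdxB8LanCκPer θ P M₁ R) : lanOfRecordSubCκPer θ P M₁ R B₁ a = zdLanPer θ.L B₁ a.toZdLanIdx P := rfl

end IndexP5κPer

section CutP5κPer

variable {θ : Stage3Params}

/-- ★★ **THE PERIODIC κ-CUT P₅-PINNED CUT RESIDUAL LAYER — the Prop-5 pin of the witness slot OF RECORD** (plan LOCATED-4 ∕ (R3′): the term `λ.cutSubBP₅κPer P M₁ R c₁ ρ₀`):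
dag-n05-e's print-class cut with Proposition 5's carriers PINNED to print's family ON THE TORUS over print's class — index `IdxB8LanCκPer θ P M₁ R`, members
`fun a => zdLanPer θ.L λ.B₁ a.toZdLanIdx P`. [cite: Balaban1985RegularSpaces, Prop. 5 p.94, Prop. 6 p.99, Thm 2 p.83, (1.3)–(1.4) p.77, p.77 («Ω_j ⊂ T_η») (objects of record)] -/
def ResidB8.cutSubBP₅κPer (lam : ResidB8 θ) (P M₁ R : ℕ) (c₁ : ℝ) (ρ₀ : ℕ) : ResidB8 θ :=
  lam.cutSubBP (IdxB8LanCκPer θ P M₁ R) (fun a => zdLanPer θ.L lam.B₁ a.toZdLanIdx P) c₁ ρ₀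

variable {P M₁ R : ℕ}

/-- Unfolding (`rfl`). [cite: Balaban1985RegularSpaces, Prop. 5 p.94 (bookkeeping)] -/
theorem ResidB8.cutSubBP₅κPer_eq_cutSubBP (lam : ResidB8 θ) (c₁ : ℝ) (ρ₀ : ℕ) :
    lam.cutSubBP₅κPer P M₁ R c₁ ρ₀ = lam.cutSubBP (IdxB8LanCκPer θ P M₁ R) (fun a => zdLanPer θ.L lam.B₁ a.toZdLanIdx P) c₁ ρ₀ := rfl

/-- Proposition 5's index ∕ members at the periodic κ-pin (`rfl` ×2). [cite: Balaban1985RegularSpaces, Prop. 5 p.94 (bookkeeping)] -/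
theorem ResidB8.cutSubBP₅κPer_I8c_lan (lam : ResidB8 θ) (c₁ : ℝ) (ρ₀ : ℕ) :
    (lam.cutSubBP₅κPer P M₁ R c₁ ρ₀).I8c = IdxB8LanCκPer θ P M₁ R ∧ (lam.cutSubBP₅κPer P M₁ R c₁ ρ₀).lan = lanOfRecordSubCκPer θ P M₁ R lam.B₁ := ⟨rfl, rfl⟩

/-- **HONESTY (no junk member)**: EVERY Proposition-5 member of the periodic κ-pinned layer is dag-n05-c's periodic datum `zdLanPer θ.L λ.B₁ ⟨η, k, Ω, Λ_k, U₀⟩ P` at a PRINT-CLASS periodic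
member and a unitary periodic background (`rfl`). [cite: Balaban1985RegularSpaces, Prop. 5 p.94, (1.3)–(1.4) p.77, p.77 («Ω_j ⊂ T_η»)] -/
theorem ResidB8.cutSubBP₅κPer_lan_apply (lam : ResidB8 θ) (c₁ : ℝ) (ρ₀ : ℕ) (a : IdxB8LanCκPer θ P M₁ R) :
    (lam.cutSubBP₅κPer P M₁ R c₁ ρ₀).lan a = zdLanPer θ.L lam.B₁ a.toZdLanIdx P := rfl

/-- ★ **HONESTY (every honest datum is a member)**: for EVERY member `j` of dag-n05-w1's print-class periodic index `IdxB8SubDPerκ θ P M₁ R` and EVERY unitary `P`-periodic background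
`U₀`, dag-n05-c's periodic Proposition-5 datum at `⟨j's geometry, U₀⟩` IS a Proposition-5 member of the layer (`rfl`). [cite: Balaban1985RegularSpaces, Prop. 5 p.94, (1.3)–(1.5) p.77, p.77 («Ω_j ⊂ T_η»)] -/
theorem ResidB8.exists_mem_cutSubBP₅κPer_lan_eq_zdLanPer (lam : ResidB8 θ) (c₁ : ℝ) (ρ₀ : ℕ) (j : IdxB8SubDPerκ θ P M₁ R)
    (U₀ : B7Prop1Explicit.Site θ.D → Fin θ.D → θ.𝔸ˣ) (hU₀ : ∀ x κ, U₀ x κ ∈ unitaryUnits θ.𝔸) (hper : IsPeriodic P U₀) :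
    ∃ a : (lam.cutSubBP₅κPer P M₁ R c₁ ρ₀).I8c, (lam.cutSubBP₅κPer P M₁ R c₁ ρ₀).lan a =
      zdLanPer θ.L lam.B₁ ⟨j.1.1.1.1.1.1.η, j.1.1.1.1.1.1.hη, j.1.1.1.1.1.1.k, j.1.1.1.1.1.1.hk, j.1.1.1.1.1.1.Ω, j.1.1.1.1.1.1.Λs j.1.1.1.1.1.1.k, U₀, hU₀⟩ P :=
  ⟨IdxB8LanCκPer.mk j U₀ hU₀ hper, rfl⟩

/-- Proposition 6's index ∕ members (UNCUT, proved class-wide), the threshold and the layer's constants at the periodic κ-pin (`rfl` ×12).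
[cite: Balaban1985RegularSpaces, Prop. 6 p.99, Thm 2 p.83, Prop. 3 p.87, Thm 4 p.88, Prop. 7 p.100 (bookkeeping)] -/
theorem ResidB8.cutSubBP₅κPer_consts (lam : ResidB8 θ) (c₁ : ℝ) (ρ₀ : ℕ) :
    (lam.cutSubBP₅κPer P M₁ R c₁ ρ₀).I8d = IdxB8SubB θ ∧ (lam.cutSubBP₅κPer P M₁ R c₁ ρ₀).cub = (fun j : IdxB8SubB θ => zdCubP θ.𝔸 θ.L ρ₀ j.1.1) ∧
      (lam.cutSubBP₅κPer P M₁ R c₁ ρ₀).c₁ = c₁ ∧ (lam.cutSubBP₅κPer P M₁ R c₁ ρ₀).β = lam.β ∧ (lam.cutSubBP₅κPer P M₁ R c₁ ρ₀).len = lam.len ∧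
      (lam.cutSubBP₅κPer P M₁ R c₁ ρ₀).inp = lam.inp ∧ (lam.cutSubBP₅κPer P M₁ R c₁ ρ₀).C₂ = lam.C₂ ∧ (lam.cutSubBP₅κPer P M₁ R c₁ ρ₀).B₁' = lam.B₁' ∧
      (lam.cutSubBP₅κPer P M₁ R c₁ ρ₀).B₁ = lam.B₁ ∧ (lam.cutSubBP₅κPer P M₁ R c₁ ρ₀).B₂ = lam.B₂ ∧ (lam.cutSubBP₅κPer P M₁ R c₁ ρ₀).B₀β = lam.B₀β ∧
      (lam.cutSubBP₅κPer P M₁ R c₁ ρ₀).toAxial = lam.toAxial :=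
  ⟨rfl, rfl, rfl, rfl, rfl, rfl, rfl, rfl, rfl, rfl, rfl, rfl⟩

/-- Non-vacuity of BOTH located indices at the periodic κ-pin for `1 ≤ M₁`, `θ.L ≤ R·M₁`, `0 < P`, `M₁·θ.L ∣ P`. [cite: Balaban1985RegularSpaces, Prop. 5 p.94, Prop. 6 p.99 (bookkeeping)] -/
theorem ResidB8.nonempty_cutSubBP₅κPer_I8c_I8d (lam : ResidB8 θ) (c₁ : ℝ) (ρ₀ : ℕ) (hM₁ : 1 ≤ M₁) (hRM : θ.L ≤ R * M₁) (hP : 0 < P) (hdvd : M₁ * θ.L ∣ P) :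
    Nonempty (lam.cutSubBP₅κPer P M₁ R c₁ ρ₀).I8c ∧ Nonempty (lam.cutSubBP₅κPer P M₁ R c₁ ρ₀).I8d :=
  ⟨nonempty_idxB8LanCκPer hM₁ hRM hP hdvd, B8IdxB8LawsB.nonempty_idxB8SubB θ⟩

/-- ★★ **THE WITNESS SLOT OF RECORD AT THE PERIODIC κ-PIN READS** (`Iff.rfl`): dag-n05-w1's κ-cut periodic δ₂-slot `B8LeafOfRecordSubBP₂DPerκ θ P M₁ R ⟨λ.cutSubBP₅κPer P M₁ R c₁ ρ₀, ax⟩`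
IS the `B8LeafRS` leaf over the periodic δ₂-members AT THE PRINT-CLASS PERIODIC MEMBERS `IdxB8SubDPerκ θ P M₁ R`, Proposition 5 at the PERIODIC MEMBERS OF RECORD `lanOfRecordSubCκPer θ P M₁ R λ.B₁`
(`zdLanPer`, one period `P` for the leaf AND Prop 5), Proposition 6 at the print cubes, the axial slot `ax ∘ val`, threshold `c₁` — EVERY [B8]-geometry-reading index is print's (1.3)–(1.4)
class at the pinned `M₁`, on the torus. [cite: Balaban1985RegularSpaces, Lemma 1 – Thm 8 pp.79–101, Prop. 5 p.94, (1.3)–(1.4) p.77, p.77 («Ω_j ⊂ T_η») (bookkeeping)] -/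
theorem b8LeafOfRecordSubBP₂DPerκ_cutSubBP₅κPer_iff (lam : ResidB8 θ) (c₁ : ℝ) (ρ₀ : ℕ)
    (ax : ∀ j : IdxB8SubDPer θ P, (famB8OfRecordPer θ (lam.cutSubBP₅κPer P M₁ R c₁ ρ₀).β (lam.cutSubBP₅κPer P M₁ R c₁ ρ₀).len P j).Cfg →
      (famB8OfRecordPer θ (lam.cutSubBP₅κPer P M₁ R c₁ ρ₀).β (lam.cutSubBP₅κPer P M₁ R c₁ ρ₀).len P j).Pert →
      (famB8OfRecordPer θ (lam.cutSubBP₅κPer P M₁ R c₁ ρ₀).β (lam.cutSubBP₅κPer P M₁ R c₁ ρ₀).len P j).Pert) :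
    B8LeafOfRecordSubBP₂DPerκ θ P M₁ R ⟨lam.cutSubBP₅κPer P M₁ R c₁ ρ₀, ax⟩ ↔
      B8LeafRS θ.D (θ.L : ℝ) lam.C₂ lam.B₁' lam.inp.B₀' lam.B₁ lam.B₂ c₁ lam.inp lam.B₀β (blockPairNA θ.D θ.L θ.𝔸)
        (fun j : IdxB8SubDPerκ θ P M₁ R => famB8OfRecordSubBP₂DPer θ lam.β lam.len P j.1) (lanOfRecordSubCκPer θ P M₁ R lam.B₁)
        (fun j : IdxB8SubB θ => zdCubP θ.𝔸 θ.L ρ₀ j.1.1) (fun j => ax j.1) :=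
  Iff.rfl

/-- **PROPOSITION 5's TWO CONJUNCTS OF THE WITNESS SLOT OF RECORD ARE PRINT'S SENTENCES ON THE TORUS OVER PRINT'S CLASS, member by member** (`Iff.rfl` ×2; dag-n05-c's `zdLanPer`
fields are `zdLan`'s at the underlying periodic data): existence (1.108) with the bound `8B₀′B₁(α₀+α₁)` among PERIODIC gauge parameters and uniqueness (1.109) among them.
[cite: Balaban1985RegularSpaces, Prop. 5 (1.107)–(1.109) p.94, (1.3)–(1.4) p.77, p.77 («Ω_j ⊂ T_η»)] -/
theorem prop5_cutSubBP₅κPer_reads (lam : ResidB8 θ) (c₁ : ℝ) (ρ₀ : ℕ) :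
    (B8.Prop5Exists (lam.cutSubBP₅κPer P M₁ R c₁ ρ₀).inp.B₀' (lam.cutSubBP₅κPer P M₁ R c₁ ρ₀).B₁ (lam.cutSubBP₅κPer P M₁ R c₁ ρ₀).lan ↔
        ∃ c₂ : ℝ, 0 < c₂ ∧ ∀ a : IdxB8LanCκPer θ P M₁ R, ∀ α₀ α₁ : ℝ, 0 < α₀ → 0 < α₁ → α₀ + α₁ ≤ c₂ →
          ∀ U₁ : (zdLanPer θ.L lam.B₁ a.toZdLanIdx P).Cfg, (zdLan θ.L lam.B₁ a.toZdLanIdx).Hyp169 α₀ α₁ U₁.1 →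
            ∃ l : (zdLanPer θ.L lam.B₁ a.toZdLanIdx P).Lam, (zdLan θ.L lam.B₁ a.toZdLanIdx).Solves U₁.1 l.1 ∧
              (zdLan θ.L lam.B₁ a.toZdLanIdx).lamNorm l.1 < 8 * lam.inp.B₀' * lam.B₁ * (α₀ + α₁)) ∧
    (B8.Prop5Unique (lam.cutSubBP₅κPer P M₁ R c₁ ρ₀).lan ↔
        ∃ c₂ c₃ : ℝ, 0 < c₂ ∧ 0 < c₃ ∧ ∀ a : IdxB8LanCκPer θ P M₁ R, ∀ α₀ α₁ : ℝ, 0 < α₀ → 0 < α₁ → α₀ + α₁ ≤ c₂ →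
          ∀ U₁ : (zdLanPer θ.L lam.B₁ a.toZdLanIdx P).Cfg, (zdLan θ.L lam.B₁ a.toZdLanIdx).Hyp169 α₀ α₁ U₁.1 →
            ∀ l₁ l₂ : (zdLanPer θ.L lam.B₁ a.toZdLanIdx P).Lam, (zdLan θ.L lam.B₁ a.toZdLanIdx).Solves U₁.1 l₁.1 → (zdLan θ.L lam.B₁ a.toZdLanIdx).Solves U₁.1 l₂.1 →
              (zdLan θ.L lam.B₁ a.toZdLanIdx).lamNorm l₁.1 < c₃ → (zdLan θ.L lam.B₁ a.toZdLanIdx).lamNorm l₂.1 < c₃ → l₁ = l₂) :=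
  ⟨Iff.rfl, Iff.rfl⟩

end CutP5κPer

end Literature.MathematicalPhysics.QuantumFieldTheory.Balaban1983to89.Node00

end
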